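import Summits.BirchSwinnertonDyer.Rank1Residual.X9.SurjBigImage
import Literature.NumberTheory.EllipticCurves.BSDSelmerPConverseRamifiedProofs
import Literature.NumberTheory.EllipticCurves.Wuthrich2014.ThreeAdicImage
import Literature.NumberTheory.EllipticCurves.Rank1Residual.X9NoEntry
import HarnessLib

/-!
# (im) from the census's printed witnesses, at EVERY prime: `surj(p) ∧ ram(p)`, and `p = 3`
# (cell `b2b-bsdres`, unit `b2b-bsdres-x9`, gen 9)

HONEST FRAMING (run/shared/lean/b2b/bsd-rank1-residual/, verbatim in every file): the goal of the
cell is to DELETE the COMBINATION-SHAPED residual classes of the Birch–Swinnerton-Dyer formula for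
ALL analytic-rank `≤ 1` elliptic curves over `ℚ` — "full BSD formula for every rank `≤ 1` curve in
class `C`" assembled STRICTLY from published theorems — so that the rank-`≤ 1` remainder becomes
exactly the CONSTRUCTION-SHAPED classes, which are TYPED (missing-input `Prop`s), NOT attempted.
This is not "finishing BSD". Nothing here is a class theorem; no named fact is introduced
(theorems only; Wuthrich 2014 Lemma 20 enters as the tree's existing named fact, as a hypothesis).

`X9/SurjBigImage.lean` proves `X9.bigIm_of_hasSurjectiveModNGaloisRep_pow`: for every prime `p`,
`p`-adic surjectivity (all `ρ̄_{E,p^n}` onto) gives Burungale–Castella–Skinner's (im) (`BigIm W p`)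
literally, and `X9.bigIm_of_surj` (`p ≥ 5`, surj alone, Serre).  The census (RESIDUAL-CASES
§a.0–§a.1; rows C1 / C16 / `T-BCS`) reads (im) off two printed witnesses; here both become kernel
implications INTO `BigIm`:

* `bigIm_of_surj_of_ram` — EVERY prime `p`: `surj(p) ∧ ram(p) ⟹ (im)`, through the tree theorem
  `hasSurjectiveModNGaloisRep_pow_of_hasMultiplicativeReductionAtPrime` (Burungale–Skinner–Tian–Wan
  (sur_ℚ) + (ram) ⟹ (sur): the inertia transvection at the multiplicative prime lifts surjectivity
  to all levels, `p = 2, 3` included);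
* `bigIm_of_irr_of_ram` — EVERY prime `p`: `irr(p) ∧ ram(p) ⟹ (im)` (with the x9 seat's
  `surj_of_irr_of_ram`): row C1's hypothesis pair carries (im);
* `bigIm_three_of_surj` — `p = 3`, good or multiplicative reduction at `3`, `surj(3) ⟹ (Im)`,
  granted Wuthrich, Doc. Math. 19 (2014) Lemma 20 (named fact
  `Wuthrich2014.lemma20_surjective_threeAdic_of_semistable`: `ρ̄_{E,3}` onto and `9 ∤ N` ⟹ `ρ_{E,3}`
  onto); this is the "(Im) ⇐ surj(3) [Wuthrich 2014 Lemma 20]" of row C16 (Yan–Zhu at `p = 3`) and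
  of `Rank1Residual.bsdp_of_classX10_of_surj`;
* `bigIm_three_of_classX10_of_surj` — on class X10 (`3` good ordinary) the census bit `surj(3)`
  IS (Im), granted Lemma 20; with the x9 seat's `ClassX10.not_bigIm_of_not_surj` the X10
  dichotomy `surj(3) ↔ (Im)` (`bigIm_three_iff_surj_of_classX10`).

References: Burungale–Skinner–Tian–Wan arXiv:2409.01350 Part II (sur)/(ram); Skinner 2016 §2.5;
Wuthrich 2014 Lemma 20 (p. 399); Serre 1972 §4; RESIDUAL-CASES.md §a.0, §a.1 rows C1/C16.
-/

noncomputable section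

open scoped Classical

open WeierstrassCurve Field Literature.NumberTheory.EllipticCurves
  Literature.NumberTheory.EllipticCurves.Rank1Residual

namespace Summit.BirchSwinnertonDyer.Rank1Residual.X9

variable (W : WeierstrassCurve ℚ) [W.IsElliptic] [W.IsGloballyMinimal] (p : ℕ) [Fact p.Prime]

/-- **`surj(p) ∧ ram(p) ⟹ (im)`, for EVERY prime `p`** (also `p = 2, 3`): a ramified multiplicative
prime `ℓ ≠ p` (`Ram W p`: `ℓ ∥ N`, `p ∤ v_ℓ(Δ_min)`) supplies an inertia transvection that lifts
mod-`p` surjectivity to every level `p^n` (tree theorem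
`hasSurjectiveModNGaloisRep_pow_of_hasMultiplicativeReductionAtPrime`), and `p`-adic surjectivity
gives (im) (`bigIm_of_hasSurjectiveModNGaloisRep_pow`).  Rows C1 (Skinner 2016 Thm. C: (irr) +
(ram)) and the `p = 3` uses of (sur) + (ram) thus carry (im) in the kernel. [folklore] -/
theorem bigIm_of_surj_of_ram (hsurj : Surj W p) (hram : Ram W p) : BigIm W p :=
  bigIm_of_hasSurjectiveModNGaloisRep_pow W p
    (hasSurjectiveModNGaloisRep_pow_of_hasMultiplicativeReductionAtPrime W p hsurj hram)

/-- **`irr(p) ∧ ram(p) ⟹ (im)`, for EVERY prime `p`.**  At an irreducible prime, a ramified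
multiplicative prime already forces surjectivity (x9 seat's `surj_of_irr_of_ram`, `X9NoEntry.lean`:
the inertia transvection plus Serre's Prop. 15), and then `bigIm_of_surj_of_ram`.  So the
hypothesis pair (irr) + (ram) of Skinner 2016 Thm. C / Skinner–Urban (row C1) implies BCS's (im)
in the kernel at every prime, `p = 3` included. [folklore] -/
theorem bigIm_of_irr_of_ram (hirr : Irr W p) (hram : Ram W p) : BigIm W p :=
  bigIm_of_surj_of_ram W p (surj_of_irr_of_ram W p hirr hram) hram

omit [W.IsGloballyMinimal] in
/-- **`p = 3`: `surj(3) ⟹ (Im)` at a prime `3` of good or multiplicative reduction**, granted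
Wuthrich, Doc. Math. 19 (2014), Lemma 20 (named fact `hW20`: `ρ̄_{E,3}` onto, `9 ∤ N` ⟹ every
`ρ̄_{E,3^n}` onto — Elkies' exotic `3`-adic images all have additive reduction at `3`); then
`bigIm_of_hasSurjectiveModNGaloisRep_pow`.  Mod-`3` surjectivity alone does NOT give `3`-adic
surjectivity (Serre 1968 IV-23, the `ℓ = 3` exception), whence the reduction hypothesis.
[cite: Wuthrich2014, Lemma 20 (p. 399)] -/
theorem bigIm_three_of_surj
    (hW20 : Wuthrich2014.lemma20_surjective_threeAdic_of_semistable)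
    (hred : W.HasGoodReductionAtPrime 3 ∨ W.HasMultiplicativeReductionAtPrime 3)
    (hsurj : Surj W 3) : BigIm W 3 :=
  bigIm_of_hasSurjectiveModNGaloisRep_pow W 3 (hW20 W hred hsurj)

/-- **On class X10 (`3` good ordinary, `E[3]` irreducible, off the printed floor) the census bit
`surj(3)` gives (Im)**, granted Wuthrich 2014 Lemma 20 — the image witness behind
`Rank1Residual.bsdp_of_classX10_of_surj` (Yan–Zhu 2026 Thm. 4.15 at `p = 3`, row C16), now landing
in `BigIm W 3` itself. [cite: Wuthrich2014, Lemma 20 (p. 399)] -/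
theorem bigIm_three_of_classX10_of_surj
    (hW20 : Wuthrich2014.lemma20_surjective_threeAdic_of_semistable) (hX : ClassX10 W p)
    (hsurj : Surj W 3) : BigIm W 3 :=
  bigIm_three_of_surj W hW20 (Or.inl hX.2.1.1) hsurj

/-- **The X10 dichotomy on the census bit is the (Im) dichotomy**: on class X10, granted Wuthrich
2014 Lemma 20, `(Im) ↔ surj(3)` (`→`: the x9 seat's `ClassX10.not_bigIm_of_not_surj`, Serre's
Prop. 15; `←`: `bigIm_three_of_classX10_of_surj`).  So the typed sub-class X10b = X10 ∧ ¬surj(3)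
(referee R6.1) is EXACTLY X10 ∧ ¬(Im). [cite: Wuthrich2014, Lemma 20 (p. 399)] -/
theorem bigIm_three_iff_surj_of_classX10
    (hW20 : Wuthrich2014.lemma20_surjective_threeAdic_of_semistable) (hX : ClassX10 W p) :
    BigIm W 3 ↔ Surj W 3 :=
  ⟨fun h ↦ by_contra fun hns ↦ ClassX10.not_bigIm_of_not_surj W p hX hns h,
    bigIm_three_of_classX10_of_surj W p hW20 hX⟩

end Summit.BirchSwinnertonDyer.Rank1Residual.X9
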